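import Summits.NavierStokesRegularity.NavierStokesRegularity.Theorems.ExtremiserTransienceNearExtremalTransienceExtremiserLiouvilleConstantSpeedMultiplierStrongEL
import HarnessLib

/-!
# Crux `ExtremiserTransience.NearExtremalTransience` (stmt-NavierStokesRegularity-21883), line `extremiser_liouville`,
# stub K1b — THE TWIST SET OF THE RESIDUE OBJECT: open-dense dichotomy, and the twist-free branch modulo minimal-foliation rigidity

`--supports stmt-NavierStokesRegularity-21883` (helper).  Author: prover seat `ns-el-k1b` (g3).

The strong Euler–Lagrange system of `…ConstantSpeedMultiplierStrongEL` lives on the twist set `U = {⟪v, curl v⟫ ≠ 0}` of the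
(analytic) residue object.  This file records the dichotomy and isolates the twist-free branch:

* `analyticOnNhd_twist` : the twist `x ↦ ⟪v x, curl v x⟫` of an analytic field is analytic;
* `twist_dichotomy` : for analytic `v`, EITHER `⟪v, curl v⟫ ≡ 0` (twist-free) OR the twist set `{⟪v,curl v⟫ ≠ 0}` is (open
  and) DENSE (identity principle) — so in the second case `μ = (⟪G,v⟫/⟪v,curl v⟫)dx` and `G = curl(qv)` hold on an open dense set;
* `not_twistFree_of_rigidity` : the twist-free branch is EXCLUDED by the classical rigidity of minimal foliations of `ℝ³`, taken
  here as an explicit HYPOTHESIS (not a tree fact): «a smooth unit divergence-free field on ℝ³ with `w · curl w ≡ 0` is constant»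
  (Frobenius: `w^⊥` integrable, `w` = unit normal of a foliation by surfaces; `div w = −2H = 0`: minimal leaves, calibrated by
  `ι_w dvol`, hence area-minimising, complete, orientable, hence planes — Fischer-Colbrie–Schoen 1980 / do Carmo–Peng 1979,
  Solomon, Comment. Math. Helv. 61 (1986); acquisition acq-14118 — pairwise disjoint, hence parallel).  Under that hypothesis a
  residue object (`M√Z√W > 0`) is never twist-free, and (`twistSet_dense_of_rigidity`) its twist set is open dense.

WHAT THIS IS NOT: the rigidity hypothesis is NOT discharged here (conditional branch closure); K1b is NOT proved; nothing here
proves NS regularity. [folklore]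
-/

noncomputable section

open Set Filter Topology MeasureTheory Metric Function
open scoped ENNReal NNReal Topology InnerProductSpace RealInnerProductSpace ContDiff
open Literature.Analysis.FluidPDE Literature.Analysis

namespace Summit.NavierStokesRegularity.NavierStokesRegularity.Theorems

-- the problem directory repeats the summit name (`NavierStokesRegularity/NavierStokesRegularity`)
set_option linter.dupNamespace false

namespace ExtremiserLiouville

open DepletionLadder.KStar DepletionLadder.KStar.HalfSpace

variable {v : E3 → E3}

/-! ## Analyticity of the twist and the open-dense dichotomy -/

/-- The twist `⟪v, curl v⟫` of an analytic field is analytic. [folklore] -/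
theorem analyticOnNhd_twist (han : AnalyticOnNhd ℝ v univ) : AnalyticOnNhd ℝ (fun x => ⟪v x, curl v x⟫_ℝ) univ := by
  have hcurl : AnalyticOnNhd ℝ (curl v) univ := by
    rw [curl_eq_curlCLM_comp]
    exact curlCLM.comp_analyticOnNhd han.fderiv
  have hv_i : ∀ i : Fin 3, AnalyticOnNhd ℝ (fun x => v x i) univ := fun i =>
    (EuclideanSpace.proj i : E3 →L[ℝ] ℝ).comp_analyticOnNhd han
  have hc_i : ∀ i : Fin 3, AnalyticOnNhd ℝ (fun x => curl v x i) univ := fun i =>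
    (EuclideanSpace.proj i : E3 →L[ℝ] ℝ).comp_analyticOnNhd hcurl
  have heq : (fun x => ⟪v x, curl v x⟫_ℝ) = fun x => ∑ i, curl v x i * v x i := by
    funext x
    simp only [PiLp.inner_apply, RCLike.inner_apply, conj_trivial]
  rw [heq]
  exact Finset.analyticOnNhd_fun_sum _ fun i _ => (hc_i i).mul (hv_i i)

/-- **Twist dichotomy** for an analytic field: either the twist vanishes identically, or the twist set
`{⟪v, curl v⟫ ≠ 0}` is dense (its complement has empty interior), by the identity principle. [folklore] -/
theorem twist_dichotomy (han : AnalyticOnNhd ℝ v univ) :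
    (∀ x, ⟪v x, curl v x⟫_ℝ = 0) ∨ Dense {x | ⟪v x, curl v x⟫_ℝ ≠ 0} := by
  by_cases h : ∀ x, ⟪v x, curl v x⟫_ℝ = 0
  · exact Or.inl h
  · refine Or.inr ?_
    push Not at h
    obtain ⟨x₁, hx₁⟩ := h
    rw [dense_iff_inter_open]
    intro O hO hOne
    by_contra hempty
    rw [Set.not_nonempty_iff_eq_empty] at hempty
    -- the twist vanishes on the nonempty open set `O`, hence everywhere
    obtain ⟨x₀, hx₀⟩ := hOne
    have hzero : ∀ y ∈ O, ⟪v y, curl v y⟫_ℝ = 0 := fun y hy => by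
      by_contra hne
      have : y ∈ O ∩ {x | ⟪v x, curl v x⟫_ℝ ≠ 0} := ⟨hy, hne⟩
      rw [hempty] at this
      exact this
    have hev : (fun x => ⟪v x, curl v x⟫_ℝ) =ᶠ[𝓝 x₀] 0 := by
      filter_upwards [hO.mem_nhds hx₀] with y hy
      exact hzero y hy
    have hall := (analyticOnNhd_twist han).eqOn_zero_of_preconnected_of_eventuallyEq_zero isPreconnected_univ
      (mem_univ x₀) hev
    exact hx₁ (hall (mem_univ x₁))

/-- The twist set is open. [folklore] -/
theorem isOpen_twistSet (hv : ContDiff ℝ ∞ v) : IsOpen {x | ⟪v x, curl v x⟫_ℝ ≠ 0} :=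
  isOpen_ne_fun (hv.continuous.inner (contDiff_curl_top hv).continuous) continuous_const

/-! ## The twist-free branch, modulo the rigidity of minimal foliations of `ℝ³` -/

/-- **No twist-free residue object, given rigidity.**  If every smooth unit divergence-free field on `ℝ³` with vanishing
twist is constant (classical: Frobenius + minimal-foliation rigidity, NOT proved here), then a smooth constant-speed
divergence-free field with `M√Z√W > 0` is not twist-free. [folklore] -/
theorem not_twistFree_of_rigidity
    (hrigid : ∀ w : E3 → E3, ContDiff ℝ ∞ w → (∀ x, ‖w x‖ = 1) → VectorCalculus.IsDivFree w →
      (∀ x, ⟪w x, curl w x⟫_ℝ = 0) → ∀ x y, w x = w y)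
    (hv : ContDiff ℝ ∞ v) (hdiv : VectorCalculus.IsDivFree v) {M : ℝ} (hM : ∀ x, ‖v x‖ = M)
    (hpos : 0 < M * Real.sqrt (Zen v) * Real.sqrt (Wpa v)) :
    ¬ ∀ x, ⟪v x, curl v x⟫_ℝ = 0 := by
  intro htw
  have hM0 : 0 ≤ M := (norm_nonneg _).trans (hM 0).le
  have hMpos : 0 < M := by
    rcases hM0.eq_or_lt with h | h
    · rw [← h, zero_mul, zero_mul] at hpos; exact absurd hpos (lt_irrefl _)
    · exact h
  have hvd : Differentiable ℝ v := hv.differentiable (by simp)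
  -- the unit field `w = M⁻¹ v`
  set w : E3 → E3 := fun x => M⁻¹ • v x with hwdef
  have hw : ContDiff ℝ ∞ w := hv.const_smul M⁻¹
  have hw1 : ∀ x, ‖w x‖ = 1 := fun x => by
    rw [hwdef, norm_smul, Real.norm_eq_abs, abs_of_pos (inv_pos.2 hMpos), hM x, inv_mul_cancel₀ hMpos.ne']
  have hwdiv : VectorCalculus.IsDivFree w := isDivFree_smul_pi hvd hdiv M⁻¹
  have hcurlw : ∀ x, curl w x = M⁻¹ • curl v x := fun x => curl_const_smul (hvd x) M⁻¹
  have hwt : ∀ x, ⟪w x, curl w x⟫_ℝ = 0 := fun x => by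
    rw [hcurlw x, hwdef, real_inner_smul_left, real_inner_smul_right, htw x, mul_zero, mul_zero]
  have hconst := hrigid w hw hw1 hwdiv hwt
  -- hence `v` is constant and `curl v = 0`, contradicting `Z > 0`
  have hvconst : ∀ x, v x = v 0 := fun x => by
    have h := hconst x 0
    simp only [hwdef] at h
    have := congrArg (fun z => M • z) h
    simpa [smul_smul, mul_inv_cancel₀ hMpos.ne'] using this
  have hcurl0 : ∀ x, curl v x = 0 := fun x => by
    have hfun : v = fun _ => v 0 := funext hvconst
    rw [hfun, curl_eq_curlCLM, fderiv_const_apply, map_zero]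
  have hZ : Zen v = 0 := by simp [Zen, hcurl0]
  rw [hZ, Real.sqrt_zero, mul_zero, zero_mul] at hpos
  exact lt_irrefl _ hpos

/-- **Under rigidity, the twist set of an analytic residue object is open and dense.** [folklore] -/
theorem twistSet_dense_of_rigidity
    (hrigid : ∀ w : E3 → E3, ContDiff ℝ ∞ w → (∀ x, ‖w x‖ = 1) → VectorCalculus.IsDivFree w →
      (∀ x, ⟪w x, curl w x⟫_ℝ = 0) → ∀ x y, w x = w y)
    (hv : ContDiff ℝ ∞ v) (han : AnalyticOnNhd ℝ v univ) (hdiv : VectorCalculus.IsDivFree v) {M : ℝ}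
    (hM : ∀ x, ‖v x‖ = M) (hpos : 0 < M * Real.sqrt (Zen v) * Real.sqrt (Wpa v)) :
    IsOpen {x | ⟪v x, curl v x⟫_ℝ ≠ 0} ∧ Dense {x | ⟪v x, curl v x⟫_ℝ ≠ 0} :=
  ⟨isOpen_twistSet hv,
    (twist_dichotomy han).resolve_left (not_twistFree_of_rigidity hrigid hv hdiv hM hpos)⟩

end ExtremiserLiouville

end Summit.NavierStokesRegularity.NavierStokesRegularity.Theorems

end
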